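import Summits.PneNP.PneNP.Theorems.ChebyshevTracialDesignPairContainmentEntrywise
import Summits.PneNP.PneNP.Theorems.ChebyshevTracialDesignFiniteValued
import Summits.PneNP.PneNP.Theorems.ChebyshevTracialDesignFreeBinning
import HarnessLib

/-!
# Cell pnp-psdrank, route `ChebyshevTracialDesign`: MASK × JUNTA-FACTOR STRATEGIES ARE PRICED BY THE `r = 1` RUNG, AT EVERY DIMENSION, FOR EVERY MASK
# — `X_U = f(U)·J(U ∩ S)` with `f : cuts → [0,G]` ARBITRARY and `J` ANY psd-contraction-valued junta on `S`: value `≤ G·2^{|S|}·γ·r`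
# (brick 168; crux `TracialDecayExp20`, stmt-PneNP-19878)

Brick 168 (prover g32; MEMO-35 §3 addendum). The simplest r-uniform mechanism of the cell — condition on a pattern and apply the `r = 1` rung to each
`[0,1]`-weighted rectangle (brick 102's entrywise argument, brick 166's atoms) — prices a strategy class that the 𝒜₁ programme reached only through
the CG_1 chain: cut fields in the NONNEGATIVE SEPARABLE CONE `X_U = Σ_k a_k(U)·J_k` (`0 ≤ a_k ≤ 1` scalar cut functions, `0 ⪯ J_k ⪯ I` fixed matrices,
`k` in a finite index set `K`) against ANY psd contraction field `Y` of any dimension `r`: `Σ_{U,M} W(U,M)·tr(X_U Y_M) = Σ_k r·Σ_{U,M} W·a_k(U)·(tr(J_kY_M)/r)`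
is a sum of `|K|` `[0,1]`-weighted rectangle values, each `≤ γ` (the all-rectangle bound). The instance that matters: a JUNTA FACTOR with an ARBITRARY
MASK, `X_U = f(U)·J(U ∩ S)` (`K = 2^S`, `a_I(U) = f(U)·1[U ∩ S = I]`).
* §1 **`value_le_of_nonnegSeparable`** — any weight `W` with all-rectangle bound `γ`, any finite family `(a_k, J_k)` as above, any `0 ⪯ Y_M ⪯ I`:
  `Σ_{U,M} W(U,M)·tr((Σ_k a_k(U)·J_k)·Y_M) ≤ |K|·γ·r`.
* §2 **`value_maskedJunta_le`** — `X_U = f(U)·J(U.1 ∩ S)` with `0 ≤ f ≤ 1` and `0 ⪯ J(U ∩ S) ⪯ I` on the `t`-cuts (`W` supported on `t`-cuts):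
  value `≤ 2^{|S|}·γ·r`;
  `value_maskedJunta_le_of_mask_le` — masks `0 ≤ f ≤ G`: `≤ G·2^{|S|}·γ·r`.
* §3 **`maskedJunta_value_decay`** — UNCONDITIONAL for the route's designs (`γ = 20·e^{−a·dq n}`, `rectangleDecayExp_all_holds`): for some `a > 0` and
  all large even `n`, every balanced `B = 20` Chebyshev design, every `S`, every mask `0 ≤ f ≤ G`, every psd-contraction-valued junta `J` on `S` and
  every psd contraction field `Y` of any dimension `r`: `Σ_{U,M} W f(U) tr(J(U∩S)Y_M) ≤ G·2^{|S|}·20·e^{−a·dq n}·r` — below `e^{−a'·dq n}·r` while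
  `|S| ≤ (a − a')·dq n/ln 2`; `value_sparseDegreeOne_le` / **`sparseDegreeOne_value_decay`** — the instance `J(I) = (Σ_{p∈I}β_p)(Σ_{p∈I}β_p)ᵀ`
  (vertex-sparse degree-one factors, brick 167's class) with constant `G·2^{|S|}·20·e^{−a·dq n}·r`.
READING. (i) This SUPERSEDES brick 167's bound for vertex-sparse degree-one factors (`B_U = Σ_{p∈S} x_pβ_p` is a junta on `S`; `B_UB_Uᵀ ⪯ I`): no degree
restriction on the factor, constant `2^{|S|}` instead of `8·|S|²(2n)^{|S|}`, no `√P` tail — 167 remains a correct derivation through the CG_1 chain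
(bricks 106/108/101/150/166). (ii) Versus the junta remainder rung (brick 110c `value_le_of_junta_contractions`: `X` itself an `A`-junta, explicit remainder
`8^{|A|}C(|A|,D+1)(D+1)!/N^{D+1}`): here the junta factor carries an ARBITRARY amplitude mask `f(U)` — spread masks included — at the price of the
asymptotic rate `a` of the `r = 1` rung. (iii) For the census (MEMO-35 §4): on the STRATEGY side the «support axis» is free up to junta size `≍ dq n`;
the open heart of the amplitude classes is a factor of LARGE vertex support times a spread mask, i.e. (CG_1′)/(PC) for densely supported fields.
[cite: Rothvoss2017, §2 and Lemma 7 (PDF pp. 6–8)] [cite: KeevashLifshitz2023, Thm. 1.8] [cite: GriblingDelaatLaurent2019, §5]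
[cite: BrietDadushPokutta2014, Thm. 6 (§3)]
Stature: support/instrument (kernel lane, no defs, axioms standard) — a RUNG-type statement for a named strategy class; the design corollaries are
ASYMPTOTIC (`∃ n₁`). WHAT THIS IS NOT: nothing for factors of large support, no proof or refutation of `TracialDecayExp20`, nothing on psd rank of
P_PM(K_n) beyond the rungs, no P-vs-NP content. Supports stmt-PneNP-19878.
-/

set_option linter.dupNamespace false -- `Summit.PneNP.PneNP.…`: summit = sub-problem (D-0017)

noncomputable section

namespace Summit.PneNP.PneNP.Theorems.ChebyshevTracialDesignMaskedJuntaFactor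

open Finset Matrix Literature.Barriers.PneNP Literature.Combinatorics.Optimization
open Summit.PneNP.PneNP.Theorems.ChebyshevTracialDesignPairContainmentEntrywise (sum_mul_mul_le_of_rectangles rectBound_nonneg)
open Summit.PneNP.PneNP.Theorems.ChebyshevTracialDesignFiniteValued (trace_mul_le_card)
open Summit.PneNP.PneNP.Theorems.ChebyshevTracialDesignFreeBinning (trace_mul_nonneg_of_psd)
open Summit.PneNP.PneNP.Theorems.ChebyshevTracialDesignUnconditionalRungs (rectangleDecayExp_all_holds)

variable {n : ℕ}

/-! ### §1 The nonnegative separable cone is priced by the all-rectangle bound -/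

/-- **NONNEGATIVE SEPARABLE CUT FIELDS ARE PRICED BY THE `r = 1` RUNG, AT EVERY DIMENSION.** Let `W` be any weight whose mass on every 0/1 rectangle
is `≤ γ`, `K` a finite index type, `a_k : cuts → [0,1]`, `J_k` psd contractions of dimension `r`, and `Y` a psd contraction field. Then
`Σ_{U,M} W(U,M)·tr((Σ_k a_k(U)·J_k)·Y_M) ≤ |K|·γ·r` — each `k` contributes the `[0,1]`-weighted rectangle `a_k × (tr(J_kY_·)/r)`.
[cite: Rothvoss2017, §2 and Lemma 7 (PDF pp. 6–8)] [cite: GriblingDelaatLaurent2019, §5] -/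
theorem value_le_of_nonnegSeparable (W : OddSet n → PMatch n → ℝ) {γ : ℝ}
    (hR : ∀ (A : Finset (OddSet n)) (B : Finset (PMatch n)), ∑ U ∈ A, ∑ M ∈ B, W U M ≤ γ)
    {K : Type*} [Fintype K] {r : ℕ} (a : K → OddSet n → ℝ) (ha : ∀ k U, 0 ≤ a k U ∧ a k U ≤ 1)
    (J : K → Matrix (Fin r) (Fin r) ℝ) (hJ : ∀ k, (J k).PosSemidef ∧ (1 - J k).PosSemidef)
    (Y : PMatch n → Matrix (Fin r) (Fin r) ℝ) (hY : ∀ M, (Y M).PosSemidef ∧ (1 - Y M).PosSemidef) :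
    ∑ U : OddSet n, ∑ M : PMatch n, W U M * ((∑ k, a k U • J k) * Y M).trace ≤ (Fintype.card K : ℝ) * γ * r := by
  classical
  have hγ : 0 ≤ γ := rectBound_nonneg W hR
  -- the matching-side weights `h_k(M) = tr(J_k Y_M)/r ∈ [0,1]` (for `r = 0` everything vanishes)
  rcases Nat.eq_zero_or_pos r with hr | hr
  · subst hr
    have : ∀ (U : OddSet n) (M : PMatch n), ((∑ k, a k U • J k) * Y M).trace = 0 := fun U M => by
      rw [Matrix.trace]; simp
    simp only [this, mul_zero, sum_const_zero, Nat.cast_zero]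
    exact le_refl _
  have hrpos : (0 : ℝ) < r := by exact_mod_cast hr
  have htr0 : ∀ k M, 0 ≤ (J k * Y M).trace := fun k M => trace_mul_nonneg_of_psd (hJ k).1 (hY M).1
  have htr1 : ∀ k M, (J k * Y M).trace ≤ r := fun k M => trace_mul_le_card (hJ k).2 (hY M).1 (hY M).2
  have hh : ∀ k M, 0 ≤ (J k * Y M).trace / r ∧ (J k * Y M).trace / r ≤ 1 := fun k M =>
    ⟨div_nonneg (htr0 k M) hrpos.le, (div_le_one hrpos).2 (htr1 k M)⟩
  -- expand the trace
  have hexp : ∀ (U : OddSet n) (M : PMatch n), ((∑ k, a k U • J k) * Y M).trace = ∑ k, a k U * (J k * Y M).trace := by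
    intro U M
    rw [Matrix.sum_mul, Matrix.trace_sum]
    refine sum_congr rfl fun k _ => ?_
    rw [Matrix.smul_mul, Matrix.trace_smul, smul_eq_mul]
  have hswap : ∑ U : OddSet n, ∑ M : PMatch n, W U M * ((∑ k, a k U • J k) * Y M).trace =
      ∑ k, (r : ℝ) * ∑ U : OddSet n, ∑ M : PMatch n, W U M * (a k U * ((J k * Y M).trace / r)) := by
    calc ∑ U : OddSet n, ∑ M : PMatch n, W U M * ((∑ k, a k U • J k) * Y M).trace
        = ∑ U : OddSet n, ∑ M : PMatch n, ∑ k, W U M * (a k U * (J k * Y M).trace) := by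
          refine sum_congr rfl fun U _ => sum_congr rfl fun M _ => ?_
          rw [hexp, mul_sum]
      _ = ∑ U : OddSet n, ∑ k, ∑ M : PMatch n, W U M * (a k U * (J k * Y M).trace) := sum_congr rfl fun U _ => sum_comm
      _ = ∑ k, ∑ U : OddSet n, ∑ M : PMatch n, W U M * (a k U * (J k * Y M).trace) := sum_comm
      _ = ∑ k, (r : ℝ) * ∑ U : OddSet n, ∑ M : PMatch n, W U M * (a k U * ((J k * Y M).trace / r)) := by
          refine sum_congr rfl fun k _ => ?_
          rw [mul_sum]; refine sum_congr rfl fun U _ => ?_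
          rw [mul_sum]; refine sum_congr rfl fun M _ => ?_
          field_simp
  rw [hswap]
  calc ∑ k, (r : ℝ) * ∑ U : OddSet n, ∑ M : PMatch n, W U M * (a k U * ((J k * Y M).trace / r))
      ≤ ∑ _k : K, (r : ℝ) * γ := sum_le_sum fun k _ =>
        mul_le_mul_of_nonneg_left (sum_mul_mul_le_of_rectangles W hR (a k) (fun M => (J k * Y M).trace / r) (ha k) (hh k)) hrpos.le
    _ = (Fintype.card K : ℝ) * γ * r := by rw [sum_const, card_univ, nsmul_eq_mul]; ring

/-! ### §2 Mask × junta factor -/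

/-- **MASK × JUNTA FACTOR.** Any weight `W` supported on the `t`-cuts with all-rectangle bound `γ`; a vertex set `S`; a mask `0 ≤ f ≤ 1` (no structure);
a matrix-valued junta `J : 𝒫([n]) → Sym_r` with `0 ⪯ J(U ∩ S) ⪯ I` for every `t`-cut `U`; a psd contraction field `Y`. Then
`Σ_{U,M} W(U,M)·f(U)·tr(J(U ∩ S)·Y_M) ≤ 2^{|S|}·γ·r`. [cite: Rothvoss2017, §2 and Lemma 7 (PDF pp. 6–8)] [cite: GriblingDelaatLaurent2019, §5] -/
theorem value_maskedJunta_le (W : OddSet n → PMatch n → ℝ) {γ : ℝ} {t : ℕ}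
    (hR : ∀ (A : Finset (OddSet n)) (B : Finset (PMatch n)), ∑ U ∈ A, ∑ M ∈ B, W U M ≤ γ)
    (hW : ∀ (U : OddSet n) (M : PMatch n), U.1.card ≠ t → W U M = 0)
    (S : Finset (Fin n)) {r : ℕ} (f : OddSet n → ℝ) (hf : ∀ U, 0 ≤ f U ∧ f U ≤ 1)
    (J : Finset (Fin n) → Matrix (Fin r) (Fin r) ℝ)
    (hJ : ∀ U : OddSet n, U.1.card = t → (J (U.1 ∩ S)).PosSemidef ∧ (1 - J (U.1 ∩ S)).PosSemidef)
    (Y : PMatch n → Matrix (Fin r) (Fin r) ℝ) (hY : ∀ M, (Y M).PosSemidef ∧ (1 - Y M).PosSemidef) :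
    ∑ U : OddSet n, ∑ M : PMatch n, W U M * (f U * (J (U.1 ∩ S) * Y M).trace) ≤ (2 : ℝ) ^ S.card * γ * r := by
  classical
  -- realised patterns and the regularised junta
  set J' : Finset (Fin n) → Matrix (Fin r) (Fin r) ℝ := fun I =>
    if ∃ U : OddSet n, U.1.card = t ∧ U.1 ∩ S = I then J I else 0 with hJ'def
  have hJ'c : ∀ I, (J' I).PosSemidef ∧ (1 - J' I).PosSemidef := fun I => by
    simp only [hJ'def]
    split_ifs with h
    · obtain ⟨U, hU, hUI⟩ := h
      rw [← hUI]; exact hJ U hU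
    · refine ⟨PosSemidef.zero, ?_⟩
      rw [sub_zero]; exact PosSemidef.one
  have hJ'eq : ∀ U : OddSet n, U.1.card = t → J' (U.1 ∩ S) = J (U.1 ∩ S) := fun U hU => by
    simp only [hJ'def]; rw [if_pos ⟨U, hU, rfl⟩]
  -- index by the subsets of `S`
  set a : S.powerset → OddSet n → ℝ := fun I U => if U.1 ∩ S = I.1 ∧ U.1.card = t then f U else 0 with ha
  have ha01 : ∀ I U, 0 ≤ a I U ∧ a I U ≤ 1 := fun I U => by
    simp only [ha]; split_ifs
    · exact hf U
    · exact ⟨le_rfl, zero_le_one⟩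
  -- on a `t`-cut the separable field is `f(U)·J(U∩S)`
  have hsum : ∀ U : OddSet n, U.1.card = t → ∑ I : S.powerset, a I U • J' I.1 = f U • J (U.1 ∩ S) := by
    intro U hU
    have hmem : U.1 ∩ S ∈ S.powerset := mem_powerset.2 inter_subset_right
    have h1 : ∑ I : S.powerset, a I U • J' I.1 = ∑ I ∈ S.powerset, (if U.1 ∩ S = I ∧ U.1.card = t then f U else 0) • J' I := by
      simp only [ha]
      exact Finset.sum_coe_sort S.powerset (fun I => (if U.1 ∩ S = I ∧ U.1.card = t then f U else 0) • J' I)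
    have h2 : ∀ I ∈ S.powerset, (if U.1 ∩ S = I ∧ U.1.card = t then f U else 0) • J' I = if U.1 ∩ S = I then f U • J' I else 0 :=
      fun I _ => by
        by_cases h : U.1 ∩ S = I
        · rw [if_pos ⟨h, hU⟩, if_pos h]
        · rw [if_neg (fun h' => h h'.1), if_neg h, zero_smul]
    rw [h1, sum_congr rfl h2, Finset.sum_ite_eq, if_pos hmem, hJ'eq U hU]
  have hterm : ∀ (U : OddSet n) (M : PMatch n), W U M * (f U * (J (U.1 ∩ S) * Y M).trace) =
      W U M * ((∑ I : S.powerset, a I U • J' I.1) * Y M).trace := by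
    intro U M
    by_cases hU : U.1.card = t
    · rw [hsum U hU, Matrix.smul_mul, Matrix.trace_smul, smul_eq_mul]
    · rw [hW U M hU, zero_mul, zero_mul]
  calc ∑ U : OddSet n, ∑ M : PMatch n, W U M * (f U * (J (U.1 ∩ S) * Y M).trace)
      = ∑ U : OddSet n, ∑ M : PMatch n, W U M * ((∑ I : S.powerset, a I U • J' I.1) * Y M).trace :=
        sum_congr rfl fun U _ => sum_congr rfl fun M _ => hterm U M
    _ ≤ (Fintype.card S.powerset : ℝ) * γ * r :=
        value_le_of_nonnegSeparable W hR a ha01 (fun I : S.powerset => J' I.1) (fun I => hJ'c I.1) Y hY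
    _ = (2 : ℝ) ^ S.card * γ * r := by rw [Fintype.card_coe, card_powerset]; push_cast; ring

/-- **… with a mask `0 ≤ f ≤ G`**: `Σ_{U,M} W f(U) tr(J(U∩S)Y_M) ≤ G·2^{|S|}·γ·r`. [cite: Rothvoss2017, §2 and Lemma 7 (PDF pp. 6–8)] -/
theorem value_maskedJunta_le_of_mask_le (W : OddSet n → PMatch n → ℝ) {γ : ℝ} {t : ℕ}
    (hR : ∀ (A : Finset (OddSet n)) (B : Finset (PMatch n)), ∑ U ∈ A, ∑ M ∈ B, W U M ≤ γ)
    (hW : ∀ (U : OddSet n) (M : PMatch n), U.1.card ≠ t → W U M = 0)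
    (S : Finset (Fin n)) {r : ℕ} (f : OddSet n → ℝ) {G : ℝ} (hG : 0 ≤ G) (hf : ∀ U, 0 ≤ f U ∧ f U ≤ G)
    (J : Finset (Fin n) → Matrix (Fin r) (Fin r) ℝ)
    (hJ : ∀ U : OddSet n, U.1.card = t → (J (U.1 ∩ S)).PosSemidef ∧ (1 - J (U.1 ∩ S)).PosSemidef)
    (Y : PMatch n → Matrix (Fin r) (Fin r) ℝ) (hY : ∀ M, (Y M).PosSemidef ∧ (1 - Y M).PosSemidef) :
    ∑ U : OddSet n, ∑ M : PMatch n, W U M * (f U * (J (U.1 ∩ S) * Y M).trace) ≤ G * ((2 : ℝ) ^ S.card * γ * r) := by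
  rcases eq_or_lt_of_le hG with hG0 | hGpos
  · have hf0 : ∀ U, f U = 0 := fun U => le_antisymm (hG0 ▸ (hf U).2) (hf U).1
    have : ∑ U : OddSet n, ∑ M : PMatch n, W U M * (f U * (J (U.1 ∩ S) * Y M).trace) = 0 :=
      sum_eq_zero fun U _ => sum_eq_zero fun M _ => by rw [hf0 U]; ring
    rw [this, ← hG0, zero_mul]
  have hf1 : ∀ U, 0 ≤ f U / G ∧ f U / G ≤ 1 := fun U => ⟨div_nonneg (hf U).1 hG, (div_le_one hGpos).2 (hf U).2⟩
  have h := value_maskedJunta_le W hR hW S (fun U => f U / G) hf1 J hJ Y hY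
  have hscale : ∑ U : OddSet n, ∑ M : PMatch n, W U M * (f U * (J (U.1 ∩ S) * Y M).trace) =
      G * ∑ U : OddSet n, ∑ M : PMatch n, W U M * (f U / G * (J (U.1 ∩ S) * Y M).trace) := by
    rw [mul_sum]; refine sum_congr rfl fun U _ => ?_
    rw [mul_sum]; refine sum_congr rfl fun M _ => ?_
    field_simp
  rw [hscale]
  exact mul_le_mul_of_nonneg_left h hG

/-- **The vertex-sparse DEGREE-ONE factor as an instance** (brick 167's class, better constant): `B_U = Σ_p x_p(U)·β_p` with `β_p = 0` off `S` is the
junta `I ↦ (Σ_{p∈I}β_p)(Σ_{p∈I}β_p)ᵀ` at `I = U ∩ S`; if `B_UB_Uᵀ ⪯ I` on the `t`-cuts then for every mask `0 ≤ f ≤ G` and every psd contraction field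
`Y`: `Σ_{U,M} W f(U) tr(B_UB_UᵀY_M) ≤ G·2^{|S|}·γ·r`. [cite: GriblingDelaatLaurent2019, §5] [cite: Rothvoss2017, §2 and Lemma 7 (PDF pp. 6–8)] -/
theorem value_sparseDegreeOne_le (W : OddSet n → PMatch n → ℝ) {γ : ℝ} {t : ℕ}
    (hR : ∀ (A : Finset (OddSet n)) (B : Finset (PMatch n)), ∑ U ∈ A, ∑ M ∈ B, W U M ≤ γ)
    (hW : ∀ (U : OddSet n) (M : PMatch n), U.1.card ≠ t → W U M = 0)
    (S : Finset (Fin n)) {r m : ℕ} (f : OddSet n → ℝ) {G : ℝ} (hG : 0 ≤ G) (hf : ∀ U, 0 ≤ f U ∧ f U ≤ G)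
    (β : Fin n → Matrix (Fin r) (Fin m) ℝ) (hβS : ∀ p, p ∉ S → β p = 0)
    (hB : ∀ U : OddSet n, U.1.card = t →
      (1 - (∑ p, (if p ∈ U.1 then (1 : ℝ) else 0) • β p) * (∑ p, (if p ∈ U.1 then (1 : ℝ) else 0) • β p)ᵀ).PosSemidef)
    (Y : PMatch n → Matrix (Fin r) (Fin r) ℝ) (hY : ∀ M, (Y M).PosSemidef ∧ (1 - Y M).PosSemidef) :
    ∑ U : OddSet n, ∑ M : PMatch n, W U M *
        (f U * ((∑ p, (if p ∈ U.1 then (1 : ℝ) else 0) • β p) * (∑ p, (if p ∈ U.1 then (1 : ℝ) else 0) • β p)ᵀ * Y M).trace) ≤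
      G * ((2 : ℝ) ^ S.card * γ * r) := by
  classical
  set J : Finset (Fin n) → Matrix (Fin r) (Fin r) ℝ := fun I => (∑ p ∈ I, β p) * (∑ p ∈ I, β p)ᵀ with hJdef
  -- the degree-one factor is the junta at `U ∩ S`
  have hBU : ∀ U : OddSet n, ∑ p, (if p ∈ U.1 then (1 : ℝ) else 0) • β p = ∑ p ∈ U.1 ∩ S, β p := by
    intro U
    rw [← Finset.sum_subset (Finset.subset_univ (U.1 ∩ S))]
    · refine (sum_congr rfl fun p hp => ?_).symm
      rw [if_pos (mem_inter.1 hp).1, one_smul]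
    · intro p _ hp
      by_cases hpU : p ∈ U.1
      · have hpS : p ∉ S := fun h => hp (mem_inter.2 ⟨hpU, h⟩)
        rw [hβS p hpS, smul_zero]
      · rw [if_neg hpU, zero_smul]
  have hJU : ∀ U : OddSet n, (∑ p, (if p ∈ U.1 then (1 : ℝ) else 0) • β p) * (∑ p, (if p ∈ U.1 then (1 : ℝ) else 0) • β p)ᵀ =
      J (U.1 ∩ S) := fun U => by rw [hBU U]
  have hJ : ∀ U : OddSet n, U.1.card = t → (J (U.1 ∩ S)).PosSemidef ∧ (1 - J (U.1 ∩ S)).PosSemidef := fun U hU => by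
    refine ⟨?_, ?_⟩
    · simpa [hJdef, conjTranspose_eq_transpose_of_trivial] using Matrix.posSemidef_self_mul_conjTranspose (∑ p ∈ U.1 ∩ S, β p)
    · rw [← hJU U]; exact hB U hU
  have h := value_maskedJunta_le_of_mask_le W hR hW S f hG hf J hJ Y hY
  simp_rw [hJU]
  exact h

/-! ### §3 The design corollaries (unconditional) -/

/-- **MASK × JUNTA-FACTOR STRATEGIES, for balanced Chebyshev designs — UNCONDITIONAL, EVERY DIMENSION.** For some `a > 0` and all large even `n`: every
balanced exact design `(t, C, w)` of degree `dq n` on levels `≤ Tq n` with `Σ|w_c| ≤ 20`, every vertex set `S`, every mask `0 ≤ f ≤ G`, every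
matrix-valued junta `J` with `0 ⪯ J(U ∩ S) ⪯ I` on the `t`-cuts and every psd contraction field `Y` of any dimension `r` satisfy
`Σ_{U,M} W(U,M)·f(U)·tr(J(U ∩ S)·Y_M) ≤ G·2^{|S|}·20·exp(−a·dq n)·r`.
[cite: Rothvoss2017, §2 and Lemma 7 (PDF pp. 6–8)] [cite: KeevashLifshitz2023, Thm. 1.8] [cite: GriblingDelaatLaurent2019, §5] -/
theorem maskedJunta_value_decay :
    ∃ a : ℝ, 0 < a ∧ ∃ n₁ : ℕ, ∀ n : ℕ, n₁ ≤ n → Even n → ∀ (t : ℕ) (C : Finset ℕ) (w : ℕ → ℝ),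
      IsBalancedDesign n t (Tq n) (dq n) 20 C w → ∀ (S : Finset (Fin n)) (f : OddSet n → ℝ) (G : ℝ), 0 ≤ G → (∀ U, 0 ≤ f U ∧ f U ≤ G) →
        ∀ {r : ℕ} (J : Finset (Fin n) → Matrix (Fin r) (Fin r) ℝ),
          (∀ U : OddSet n, U.1.card = t → (J (U.1 ∩ S)).PosSemidef ∧ (1 - J (U.1 ∩ S)).PosSemidef) →
        ∀ (Y : PMatch n → Matrix (Fin r) (Fin r) ℝ), (∀ M, (Y M).PosSemidef ∧ (1 - Y M).PosSemidef) →
          ∑ U : OddSet n, ∑ M : PMatch n, levelWeight n t C w U M * (f U * (J (U.1 ∩ S) * Y M).trace) ≤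
            G * ((2 : ℝ) ^ S.card * (20 * Real.exp (-(a * (dq n : ℝ)))) * r) := by
  obtain ⟨a, ha, n₁, h⟩ := rectangleDecayExp_all_holds
  exact ⟨a, ha, n₁, fun n hn hev t C w hdes S f G hG hf r J hJ Y hY =>
    value_maskedJunta_le_of_mask_le _ (h n hn hev t C w hdes)
      (fun U M hU => ChebyshevTracialDesignRungAssembly.levelWeight_eq_zero_of_card_ne C w hU M) S f hG hf J hJ Y hY⟩

/-- **VERTEX-SPARSE DEGREE-ONE FACTORS WITH AN ARBITRARY MASK, for balanced Chebyshev designs — UNCONDITIONAL** (brick 167's rung with the constant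
`2^{|S|}` and no `√P` tail): `Σ_{U,M} W f(U) tr(B_UB_UᵀY_M) ≤ G·2^{|S|}·20·exp(−a·dq n)·r` for `B_U = Σ_{p∈S} x_pβ_p` with `B_UB_Uᵀ ⪯ I` on the `t`-cuts.
[cite: Rothvoss2017, §2 and Lemma 7 (PDF pp. 6–8)] [cite: KeevashLifshitz2023, Thm. 1.8] [cite: GriblingDelaatLaurent2019, §5] -/
theorem sparseDegreeOne_value_decay :
    ∃ a : ℝ, 0 < a ∧ ∃ n₁ : ℕ, ∀ n : ℕ, n₁ ≤ n → Even n → ∀ (t : ℕ) (C : Finset ℕ) (w : ℕ → ℝ),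
      IsBalancedDesign n t (Tq n) (dq n) 20 C w → ∀ (S : Finset (Fin n)) (f : OddSet n → ℝ) (G : ℝ), 0 ≤ G → (∀ U, 0 ≤ f U ∧ f U ≤ G) →
        ∀ {r m : ℕ} (β : Fin n → Matrix (Fin r) (Fin m) ℝ), (∀ p, p ∉ S → β p = 0) →
        (∀ U : OddSet n, U.1.card = t →
          (1 - (∑ p, (if p ∈ U.1 then (1 : ℝ) else 0) • β p) * (∑ p, (if p ∈ U.1 then (1 : ℝ) else 0) • β p)ᵀ).PosSemidef) →
        ∀ (Y : PMatch n → Matrix (Fin r) (Fin r) ℝ), (∀ M, (Y M).PosSemidef ∧ (1 - Y M).PosSemidef) →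
          ∑ U : OddSet n, ∑ M : PMatch n, levelWeight n t C w U M *
              (f U * ((∑ p, (if p ∈ U.1 then (1 : ℝ) else 0) • β p) * (∑ p, (if p ∈ U.1 then (1 : ℝ) else 0) • β p)ᵀ * Y M).trace) ≤
            G * ((2 : ℝ) ^ S.card * (20 * Real.exp (-(a * (dq n : ℝ)))) * r) := by
  obtain ⟨a, ha, n₁, h⟩ := rectangleDecayExp_all_holds
  exact ⟨a, ha, n₁, fun n hn hev t C w hdes S f G hG hf r m β hβS hB Y hY =>
    value_sparseDegreeOne_le _ (h n hn hev t C w hdes)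
      (fun U M hU => ChebyshevTracialDesignRungAssembly.levelWeight_eq_zero_of_card_ne C w hU M) S f hG hf β hβS hB Y hY⟩

end Summit.PneNP.PneNP.Theorems.ChebyshevTracialDesignMaskedJuntaFactor
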